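import Summits.QuantumFields.YangMills.Theorems.TwistedTraceScaling.Negative.AvgKernelStiffFlip
import Summits.QuantumFields.YangMills.Theorems.LuscherReductionRunningReductionTraceFormulaAveraging
import Summits.QuantumFields.YangMills.Theorems.LuscherReductionTwistedTraceScalingStiffTrialMeasurable
import HarnessLib

/-!
# The residual CONSTANT gauge group acts on the tube domain `(u, v) ↦ (Ad_g u, Ad(g) v)`, preserving the pulled-back measure and every pulled-back
# gauge-invariant function (rate twin of `stub_boRate`, crux K1 `NearFlatRatioLaw` stmt-QuantumFields-24720, line «borate»; the tube-side data of `…KernelTwist`)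

After the crux disprover's R32/R33 (`Theorems/TwistedTraceScaling/Negative/AvgKernelNoLabSlowFactor.lean`, `…AvgKernelStiffFlip.lean`) the model kernel of the rate twin's
transfer step is the TWISTED product `K^tw(x, y) = ∫_{SU(2)} K₁(x, g·y) dg` over the residual constant gauge group acting DIAGONALLY on lane A's tube domain
`X = SU(2)³ × capBalancedSet L` (`…SlowDisintegrationTubes`).  `Theorems/FlatTubeReductionKernelTwist.lean` shows the twist is free on the model side provided (hT) the action is
jointly measurable, (hmp) each `g` preserves the measure `μ = slowMeasure (orthoChart L) = σ^{⊗3} ⊗ π`, (hTmul/hTone) it is an action, and (hinv) the test functions are invariant.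
This file discharges these four inputs for the tube (def-free; the action is written out as
`(g, p) ↦ (gaugeTransform (fun _ => g) p.1, ⟨colourRotate L (fun _ => g) p.2, _⟩)`):

* §1 `gaugeTransform_const_inv` (`(u⁻¹)^g = (u^g)⁻¹` for constant `g`), ★ `slowEmb_constGauge` — under the slow embedding the diagonal action IS the constant gauge
  transformation of the torus: `slowEmb (Ad_g u, Ad(g) v) = (slowEmb (u, v))^{g}` (R33 §1 `gaugeTransform_const_orthoTube`); `constGauge_mul`, `constGauge_one` (action),
  `measurable_constGauge` (jointly in `(g, p)`), `measurable_constGauge_right`.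
* §2 ★★ `map_constGauge_slowMeasure` — (hmp): `(slowMeasure (orthoChart L)).map (Ad_g × Ad(g)) = slowMeasure (orthoChart L)` (gauge invariance of the product Haar measure,
  `measurePreserving_gaugeTransform_configMeasure`); ★ `measurePreserving_constGauge`.
* §3 ★ `comp_slowEmb_constGauge` — (hinv): the pull-back `F = ψ ∘ slowEmb` of a gauge-invariant `ψ` is invariant under the diagonal action.
HONEST FRAMING: exact symmetry/measure bookkeeping on lane A's chart for the rate twin of a registered stub of crux K1 of the CONDITIONAL reduction route `FlatTubeReduction`
(R2b1 RECORD-label femto rung; fixed lattice `(ℤ/L)³`, `β → ∞`); no kernel estimate; `stub_boRate` untouched; not infinite volume, not a mass gap, not Clay.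
-/

set_option autoImplicit false

noncomputable section

open MeasureTheory Filter Topology Real
open scoped BigOperators Matrix
open Literature.MathematicalPhysics.QuantumFieldTheory hiding SU2
open Literature.MathematicalPhysics.QuantumLattice

namespace Summit.QuantumFields.YangMills.Theorems.FemtoTransferGap.TwoLattice.ConstTube

open Summit.QuantumFields.YangMills.Theorems.FemtoTransferGap
open Summit.QuantumFields.YangMills.Theorems.FemtoTransferGap.TwoLattice.SlowChart
open Summit.QuantumFields.YangMills.Theorems.FemtoTransferGap.TwoLattice.Cov (adRot_mul adRot_one sum_sq_adRot_mulVec)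
open Summit.QuantumFields.YangMills.Theorems.TwistedTraceScaling.Negative.R33 (gaugeTransform_const_orthoTube)

variable (L : ℕ) [NeZero L]

/-! ## §1 The diagonal action of the constant gauge group on the tube domain -/

omit [NeZero L] in
/-- For a CONSTANT gauge transformation, `(U⁻¹)^g = (U^g)⁻¹` (link by link `g U_e⁻¹ g⁻¹ = (g U_e g⁻¹)⁻¹`). [folklore] -/
theorem gaugeTransform_const_inv (g : SU2) (U : GaugeConfig 3 L SU2) :
    gaugeTransform (fun _ : Site 3 L => g) U⁻¹ = (gaugeTransform (fun _ : Site 3 L => g) U)⁻¹ := by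
  funext e
  simp only [gaugeTransform, Pi.inv_apply, mul_inv_rev, inv_inv, mul_assoc]

/-- ★ **Under the slow embedding the diagonal action is the constant gauge transformation of the torus**:
`slowEmb (Ad_g u, Ad(g) v) = (slowEmb (u, v))^{g}`. [cite: Luscher1983, §3] -/
theorem slowEmb_constGauge (g : SU2) (p : GaugeConfig 3 1 SU2 × capBalancedSet L) :
    slowEmb (orthoChart L) (gaugeTransform (fun _ : Site 3 1 => g) p.1,
        ⟨colourRotate L (fun _ => g) (p.2 : Edge 3 L → Fin 3 → ℝ), colourRotate_mem_capBalancedSet L p.2.2⟩) =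
      gaugeTransform (fun _ : Site 3 L => g) (slowEmb (orthoChart L) p) := by
  simp only [slowEmb, orthoChart]
  rw [gaugeTransform_const_orthoTube g _ (fun e => sum_sq_le_one_of_cap L p.2.2.2 e), gaugeTransform_const_inv]

/-- The diagonal action is an action: composition. [folklore] -/
theorem constGauge_mul (g h : SU2) (p : GaugeConfig 3 1 SU2 × capBalancedSet L) :
    (gaugeTransform (fun _ : Site 3 1 => g * h) p.1,
        (⟨colourRotate L (fun _ => g * h) (p.2 : Edge 3 L → Fin 3 → ℝ), colourRotate_mem_capBalancedSet L p.2.2⟩ : capBalancedSet L)) =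
      (gaugeTransform (fun _ : Site 3 1 => g) (gaugeTransform (fun _ : Site 3 1 => h) p.1),
        (⟨colourRotate L (fun _ => g) (colourRotate L (fun _ => h) (p.2 : Edge 3 L → Fin 3 → ℝ)),
          colourRotate_mem_capBalancedSet L (colourRotate_mem_capBalancedSet L p.2.2)⟩ : capBalancedSet L)) := by
  refine Prod.ext ?_ (Subtype.ext ?_)
  · show gaugeTransform (fun _ : Site 3 1 => g * h) p.1 = gaugeTransform (fun _ : Site 3 1 => g) (gaugeTransform (fun _ : Site 3 1 => h) p.1)
    rw [TT.gaugeTransform_gaugeTransform]; rfl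
  · show colourRotate L (fun _ => g * h) (p.2 : Edge 3 L → Fin 3 → ℝ) = colourRotate L (fun _ => g) (colourRotate L (fun _ => h) (p.2 : Edge 3 L → Fin 3 → ℝ))
    rw [colourRotate_mul]; rfl

/-- The diagonal action is an action: unit. [folklore] -/
theorem constGauge_one (p : GaugeConfig 3 1 SU2 × capBalancedSet L) :
    (gaugeTransform (fun _ : Site 3 1 => (1 : SU2)) p.1,
        (⟨colourRotate L (fun _ => (1 : SU2)) (p.2 : Edge 3 L → Fin 3 → ℝ), colourRotate_mem_capBalancedSet L p.2.2⟩ : capBalancedSet L)) = p := by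
  refine Prod.ext ?_ (Subtype.ext ?_)
  · show gaugeTransform (fun _ : Site 3 1 => (1 : SU2)) p.1 = p.1
    exact TT.gaugeTransform_one' p.1
  · show colourRotate L (fun _ => (1 : SU2)) (p.2 : Edge 3 L → Fin 3 → ℝ) = p.2
    exact colourRotate_one L _

/-- The diagonal action is jointly measurable in `(g, p)`. [folklore] -/
theorem measurable_constGauge :
    Measurable fun q : SU2 × (GaugeConfig 3 1 SU2 × capBalancedSet L) =>
      (gaugeTransform (fun _ : Site 3 1 => q.1) q.2.1,
        (⟨colourRotate L (fun _ => q.1) (q.2.2 : Edge 3 L → Fin 3 → ℝ), colourRotate_mem_capBalancedSet L q.2.2.2⟩ : capBalancedSet L)) := by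
  haveI : SecondCountableTopology SU2 := secondCountableTopology_su2
  have hA : Measurable fun q : SU2 × (GaugeConfig 3 1 SU2 × capBalancedSet L) => gaugeTransform (fun _ : Site 3 1 => q.1) q.2.1 := by
    have hq1 : Measurable fun q : SU2 × (GaugeConfig 3 1 SU2 × capBalancedSet L) => q.1 := measurable_fst
    refine measurable_pi_lambda _ fun e => ?_
    simp only [gaugeTransform]
    exact (hq1.mul ((measurable_pi_apply e).comp (measurable_fst.comp measurable_snd))).mul hq1.inv
  have hB : Measurable fun q : SU2 × (GaugeConfig 3 1 SU2 × capBalancedSet L) => colourRotate L (fun _ => q.1) (q.2.2 : Edge 3 L → Fin 3 → ℝ) := by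
    refine measurable_pi_lambda _ fun e => measurable_pi_lambda _ fun a => ?_
    simp only [colourRotate, Matrix.mulVec, dotProduct]
    refine Finset.measurable_sum _ fun b _ => ?_
    exact (((continuous_adRot.matrix_elem a b).measurable).comp measurable_fst).mul
      ((measurable_pi_apply b).comp ((measurable_pi_apply e).comp (measurable_subtype_coe.comp (measurable_snd.comp measurable_snd))))
  exact hA.prodMk hB.subtype_mk

/-- For fixed `g` the diagonal action is measurable. [folklore] -/
theorem measurable_constGauge_right (g : SU2) :
    Measurable fun p : GaugeConfig 3 1 SU2 × capBalancedSet L =>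
      (gaugeTransform (fun _ : Site 3 1 => g) p.1,
        (⟨colourRotate L (fun _ => g) (p.2 : Edge 3 L → Fin 3 → ℝ), colourRotate_mem_capBalancedSet L p.2.2⟩ : capBalancedSet L)) := by
  have hA : Measurable fun p : GaugeConfig 3 1 SU2 × capBalancedSet L => gaugeTransform (fun _ : Site 3 1 => g) p.1 :=
    (measurePreserving_gaugeTransform_configMeasure (fun _ : Site 3 1 => g)).measurable.comp measurable_fst
  have hB : Measurable fun p : GaugeConfig 3 1 SU2 × capBalancedSet L => colourRotate L (fun _ => g) (p.2 : Edge 3 L → Fin 3 → ℝ) :=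
    (measurable_colourRotate L _).comp (measurable_subtype_coe.comp measurable_snd)
  exact hA.prodMk hB.subtype_mk

/-! ## §2 ★★ The pulled-back tube measure is invariant under the diagonal action -/

/-- The image of a translated set is the gauge translate of the image. [folklore] -/
theorem image_preimage_constGauge (g : SU2) (s : Set (GaugeConfig 3 1 SU2 × capBalancedSet L)) :
    slowEmb (orthoChart L) '' ((fun p : GaugeConfig 3 1 SU2 × capBalancedSet L =>
        (gaugeTransform (fun _ : Site 3 1 => g) p.1,
          (⟨colourRotate L (fun _ => g) (p.2 : Edge 3 L → Fin 3 → ℝ), colourRotate_mem_capBalancedSet L p.2.2⟩ : capBalancedSet L))) ⁻¹' s) =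
      gaugeTransform (fun _ : Site 3 L => g) ⁻¹' (slowEmb (orthoChart L) '' s) := by
  ext U
  simp only [Set.mem_image, Set.mem_preimage]
  constructor
  · rintro ⟨p, hp, rfl⟩
    exact ⟨_, hp, slowEmb_constGauge L g p⟩
  · rintro ⟨q, hq, hqU⟩
    refine ⟨(gaugeTransform (fun _ : Site 3 1 => g⁻¹) q.1,
        ⟨colourRotate L (fun _ => g⁻¹) (q.2 : Edge 3 L → Fin 3 → ℝ), colourRotate_mem_capBalancedSet L q.2.2⟩), ?_, ?_⟩
    · have h := constGauge_mul L g g⁻¹ q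
      rw [mul_inv_cancel] at h
      rw [← h, constGauge_one]
      exact hq
    · have h3 : ((fun _ : Site 3 L => g⁻¹) * fun _ : Site 3 L => g) = 1 := by funext x; simp
      rw [slowEmb_constGauge, hqU, TT.gaugeTransform_gaugeTransform, h3, TT.gaugeTransform_one']

/-- ★★ **(hmp) THE PULLED-BACK TUBE MEASURE IS INVARIANT UNDER THE DIAGONAL CONSTANT-GAUGE ACTION** (gauge invariance of the product Haar measure). [folklore] -/
theorem map_constGauge_slowMeasure (g : SU2) :
    (slowMeasure (orthoChart L)).map (fun p : GaugeConfig 3 1 SU2 × capBalancedSet L =>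
        (gaugeTransform (fun _ : Site 3 1 => g) p.1,
          (⟨colourRotate L (fun _ => g) (p.2 : Edge 3 L → Fin 3 → ℝ), colourRotate_mem_capBalancedSet L p.2.2⟩ : capBalancedSet L))) =
      slowMeasure (orthoChart L) := by
  haveI : PolishSpace (capBalancedSet L) := (isClosed_capBalancedSet L).polishSpace
  have hemb := measurableEmbedding_slowEmb (continuous_orthoChart L) (orthoChart_injective L)
  ext s hs
  rw [Measure.map_apply (measurable_constGauge_right L g) hs, slowMeasure_apply (continuous_orthoChart L) (orthoChart_injective L),
    slowMeasure_apply (continuous_orthoChart L) (orthoChart_injective L), image_preimage_constGauge]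
  exact (measurePreserving_gaugeTransform_configMeasure (fun _ : Site 3 L => g)).measure_preimage
    (hemb.measurableSet_image.mpr hs).nullMeasurableSet

/-- ★ (hmp) as a `MeasurePreserving` statement. [folklore] -/
theorem measurePreserving_constGauge (g : SU2) :
    MeasurePreserving (fun p : GaugeConfig 3 1 SU2 × capBalancedSet L =>
        (gaugeTransform (fun _ : Site 3 1 => g) p.1,
          (⟨colourRotate L (fun _ => g) (p.2 : Edge 3 L → Fin 3 → ℝ), colourRotate_mem_capBalancedSet L p.2.2⟩ : capBalancedSet L)))
      (slowMeasure (orthoChart L)) (slowMeasure (orthoChart L)) :=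
  ⟨measurable_constGauge_right L g, map_constGauge_slowMeasure L g⟩

/-! ## §3 (hinv) Pull-backs of gauge-invariant functions are invariant under the diagonal action -/

/-- ★ **(hinv)**: for a gauge-invariant `ψ` on the torus, `F = ψ ∘ slowEmb` is invariant under the diagonal constant-gauge action of the tube domain. [folklore] -/
theorem comp_slowEmb_constGauge {α : Type*} {ψ : GaugeConfig 3 L SU2 → α}
    (hψ : ∀ (γ : Site 3 L → SU2) (U : GaugeConfig 3 L SU2), ψ (gaugeTransform γ U) = ψ U) (g : SU2) (p : GaugeConfig 3 1 SU2 × capBalancedSet L) :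
    ψ (slowEmb (orthoChart L) (gaugeTransform (fun _ : Site 3 1 => g) p.1,
        ⟨colourRotate L (fun _ => g) (p.2 : Edge 3 L → Fin 3 → ℝ), colourRotate_mem_capBalancedSet L p.2.2⟩)) =
      ψ (slowEmb (orthoChart L) p) := by
  rw [slowEmb_constGauge, hψ]

end Summit.QuantumFields.YangMills.Theorems.FemtoTransferGap.TwoLattice.ConstTube

end
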